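import Summits.Ventures.CertifiedManyBodySolver.Observables.PhaseSeparationExclusionBoxThermal
import Literature.MathematicalPhysics.QuantumLattice.HubbardTTPrimeThermalPhaseCoexistenceHotAnchor
import Literature.MathematicalPhysics.QuantumLattice.HubbardTTPrimeThermalPressureCellRule
import HarnessLib

/-!
# Ventures/CertifiedManyBodySolver — Observables/PhaseSeparationExclusionBoxThermalHotAnchor.lean

HONEST FRAMING: the HOT-ANCHORED edition of `Observables/PhaseSeparationExclusionBoxThermal.lean` — EXCLUSION of MACROSCOPIC PHASE
COEXISTENCE (a phase of density `≤ n₁` with a phase of density `≥ n₂`) in CANONICAL THERMAL torus-limit states (sector Gibbs states)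
on a `(t′, U)` CELL of a material box, for every inverse temperature `β ≥ β₀`; the crude entropy allowance `log 4` of the parent is
replaced, at each outer density, by a CERTIFIED hot pressure ceiling `p(β_h; n_i) ≤ π_i` valid on the cell (Markov / cluster free-energy
claim nodes read at `n_i` through the kernel readers `pressureTT'_le_of_{stair,rect}MarkovCertificate[TT']` — ONE grand-canonical anchor
caps EVERY density — and spread over the cell by `pressureTT'_le_on_cell_of_lowerU_corners`); CONTROL class; conditional on the rows and
anchors the instances name; nothing about stripes / finite-period states, about which phase is realised, or about superconductivity; no
number of record. Zero compute, no definition, no claim node, no `sorry`.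

Cell `pub/hubbard-downfold` (MO-S1 ↔ S2 seam «box ↦ one word»; D-0096 (ii)+(iii): `T > 0` × competing orders), seat
`hubbard-downfold-unc-2` (`prover-hubbard-downfold-unc-2-g20-0`). Law: `not_isTorusLimitOfMixture_mix_of_hotAnchors_of_le`
(`Literature/…/HubbardTTPrimeThermalPhaseCoexistenceHotAnchor.lean`, this seat): cap `c` at the mean density, floors `f_i`, anchors
`p(β_{h,i}; n_i) ≤ π_i` (`0 ≤ β_{h,i} ≤ β`) and `a π₁ + b π₂ + β_{h,1} a f₁ + β_{h,2} b f₂ < β·(a f₁ + b f₂ − c)` exclude the coexistence;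
threshold `β₀ = [a π₁ + b π₂ + β_{h,1} a f₁ + β_{h,2} b f₂]/M` in place of `2 log 2 / M`. This file transports it over a cell exactly as
the parent's column forms:
* `chord_gt_of_ends_gt` — a `U`-chord of two numbers `> m` is `> m`;
* `psT_not_thermal_mix_on_cell_of_fns_hotAnchor` — the cell sentence from a cap function, two floor functions and two cell-uniform
  anchors, with the anchored inequality everywhere on the cell;
* `psT_not_thermal_mix_on_cell_of_columns_hotAnchor` — COLUMN × THRESHOLD FORM: cap affine in `U`, two `n₂`-column laws, a dilute floor
  `F₁(s)`, both `T = 0` column margins `≥ 0`, the anchored inequality at `β₀` on both columns (affine in `s`: two `nlinarith` checks per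
  column) and `β₀ ≤ β` ⇒ the thermal exclusion on the whole cell `[s₁, s₂] × [U₁, U₂]` at `β` (the anchored slack is the `U`-chord of
  the column slacks; `β·M ≥ β₀·M`);
* `psT_not_thermal_mix_above_column_hotAnchor` — one column law + cap non-decreasing in `U`, far-end check.
Instances: `Downfold/BoxesLa214V115M2cPhaseSeparationThermalHotAnchor.lean` (LSCO `x = 1/8` cells around `U = 8`),
`Observables/PhaseSeparationExclusionU8ThermalHotAnchor.lean` (registry point `(8, 7/8, 0)`).
References: R. B. Israel, *Convexity in the Theory of Lattice Gases* (1979) Thm I.2.4 [Israel1979]; D. Poulin, M. B. Hastings, PRL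
106 (2011) 080403 [PoulinHastings2011]; D. Ruelle, *Statistical Mechanics* (1969) §3.3 [Ruelle1969]; V. J. Emery, S. A. Kivelson,
H. Q. Lin, PRL 64 (1990) 475 [EmeryKivelsonLin1990].
-/

noncomputable section

namespace Summit.Ventures.CertifiedManyBodySolver.Observables

open Literature.MathematicalPhysics.QuantumLattice Literature.MathematicalPhysics.QuantumLattice.ThermodynamicLimit
open Literature.MathematicalPhysics.QuantumLattice.InfVolFermionState Set Filter

/-- **A chord of two numbers `> m` is `> m`** (`U₁ < U₂`, `U ∈ [U₁, U₂]`). [folklore] -/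
theorem chord_gt_of_ends_gt {U₁ U₂ U g₁ g₂ m : ℝ} (h12 : U₁ < U₂) (hU : U ∈ Icc U₁ U₂) (h₁ : m < g₁) (h₂ : m < g₂) :
    m < ((U₂ - U) * g₁ + (U - U₁) * g₂) / (U₂ - U₁) := by
  have hd : 0 < U₂ - U₁ := sub_pos.2 h12
  rw [lt_div_iff₀ hd]
  rcases eq_or_lt_of_le hU.1 with h | h
  · subst h
    have k2 := mul_le_mul_of_nonneg_left h₂.le (sub_nonneg.2 hU.1)
    nlinarith
  · have k1 := mul_le_mul_of_nonneg_left h₁.le (sub_nonneg.2 hU.2)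
    have k2 := mul_lt_mul_of_pos_left h₂ (sub_pos.2 h)
    nlinarith

/-- **HOT-ANCHORED THERMAL PS EXCLUSION ON A CELL from bound functions.** Cell `[s₁, s₂] × [U₁, U₂]` (`U₁ ≥ 0`), `β > 0`,
densities `0 ≤ n₁ < n₂ < 2`, weights `a, b ≥ 0`, `a + b = 1`; a cap function `C` at `a n₁ + b n₂` and floor functions `F₁, F₂` at
`n₁, n₂` (bounds on the GROUND-STATE energy density) valid on the cell; CELL-UNIFORM pressure ceilings `p(β_{h,1}; t,s,U; n₁) ≤ π₁`,
`p(β_{h,2}; t,s,U; n₂) ≤ π₂` (`0 ≤ β_{h,i} ≤ β`); and `a π₁ + b π₂ + β_{h,1}·(a F₁) + β_{h,2}·(b F₂) < β·(a F₁ + b F₂ − C)` everywhere on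
the cell. Then at every `(s, U)` of the cell no mixture `λω₁ + (1−λ)ω₂` (`0 < λ < 1`) of translation-invariant states with
`0 < ρ(ω₁) ≤ n₁`, `n₂ ≤ ρ(ω₂) < 2` is a canonical thermal torus-limit state at `(β; t, s, U; n)`, for any `0 < n < 2`.
[cite: Israel1979, Thm. I.2.4] [cite: PoulinHastings2011, eqs. (3)–(8)] -/
theorem psT_not_thermal_mix_on_cell_of_fns_hotAnchor (t : ℝ) {s₁ s₂ U₁ U₂ n₁ n₂ a b β βh₁ βh₂ π₁ π₂ : ℝ} (hU₁ : 0 ≤ U₁)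
    (hβ : 0 < β) (hn₁ : 0 ≤ n₁) (hn : n₁ < n₂) (hn₂ : n₂ < 2) (ha : 0 ≤ a) (hb : 0 ≤ b) (hab : a + b = 1)
    (hβh₁ : 0 ≤ βh₁) (hβh₂ : 0 ≤ βh₂) (hle₁ : βh₁ ≤ β) (hle₂ : βh₂ ≤ β) {C F₁ F₂ : ℝ → ℝ → ℝ}
    (hC : ∀ s ∈ Icc s₁ s₂, ∀ U ∈ Icc U₁ U₂, energyDensityTT' t s U (a * n₁ + b * n₂) ≤ C s U)
    (hF₁ : ∀ s ∈ Icc s₁ s₂, ∀ U ∈ Icc U₁ U₂, F₁ s U ≤ energyDensityTT' t s U n₁)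
    (hF₂ : ∀ s ∈ Icc s₁ s₂, ∀ U ∈ Icc U₁ U₂, F₂ s U ≤ energyDensityTT' t s U n₂)
    (hπ₁ : ∀ s ∈ Icc s₁ s₂, ∀ U ∈ Icc U₁ U₂, pressureTT' βh₁ t s U n₁ ≤ π₁)
    (hπ₂ : ∀ s ∈ Icc s₁ s₂, ∀ U ∈ Icc U₁ U₂, pressureTT' βh₂ t s U n₂ ≤ π₂)
    (hpos : ∀ s ∈ Icc s₁ s₂, ∀ U ∈ Icc U₁ U₂,
      a * π₁ + b * π₂ + βh₁ * (a * F₁ s U) + βh₂ * (b * F₂ s U) < β * (a * F₁ s U + b * F₂ s U - C s U))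
    {s : ℝ} (hs : s ∈ Icc s₁ s₂) {U : ℝ} (hU : U ∈ Icc U₁ U₂)
    {ω₁ ω₂ : InfVolFermionState 2} (h₁ : ω₁.IsTranslationInvariant) (h₂ : ω₂.IsTranslationInvariant)
    (hρ₁ : 0 < ω₁.density) (hρ₁' : ω₁.density ≤ n₁) (hρ₂ : n₂ ≤ ω₂.density) (hρ₂' : ω₂.density < 2)
    {n : ℝ} (hn0 : 0 < n) (hn2 : n < 2) {lam : ℝ} (hl0 : 0 < lam) (hl1 : lam < 1) {Ls : ℕ → ℕ}
    (hLs : Tendsto Ls atTop atTop) :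
    ¬ (mix lam hl0.le hl1.le ω₁ ω₂).IsTorusLimitOfMixture (sectorGibbsCount n) (fun L => sectorGibbsWeightTT' β t s U n L)
      (fun L => sectorGibbsVectorTT' t s U n L) Ls :=
  not_isTorusLimitOfMixture_mix_of_hotAnchors_of_le t s (hU₁.trans hU.1) hβ h₁ h₂ hρ₁ hρ₂' hn₁ hn₂ hρ₁' hn hρ₂ ha hb hab
    (hC s hs U hU) (hF₁ s hs U hU) (hF₂ s hs U hU) hβh₁ hβh₂ hle₁ hle₂ (hπ₁ s hs U hU) (hπ₂ s hs U hU) (hpos s hs U hU)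
    hn0 hn2 hl0 hl1 hLs

/-- **HOT-ANCHORED THERMAL PS EXCLUSION ON A CELL, COLUMN × THRESHOLD FORM.** Cell `[s₁, s₂] × [U₁, U₂]` (`0 ≤ U₁ < U₂`),
`0 ≤ n₁ < n₂ < 2`, weights `a + b = 1`; cap `e(t, s, U, a n₁ + b n₂) ≤ c₀ + c₁·U` on the cell; column laws `L_i(s) ≤ e(t, s, U_i, n₂)`;
dilute floor `F₁(s) ≤ e(t, s, U, n₁)` on the cell; cell-uniform anchors `p(β_{h,1}; n₁) ≤ π₁`, `p(β_{h,2}; n₂) ≤ π₂` with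
`0 ≤ β_{h,i} ≤ β₀ ≤ β`; on BOTH columns the `T = 0` margin is `≥ 0` and the ANCHORED INEQUALITY holds at `β₀`:
`a π₁ + b π₂ + β_{h,1} a F₁(s) + β_{h,2} b L_i(s) < β₀·(a F₁(s) + b L_i(s) − (c₀ + c₁ U_i))` for every `s ∈ [s₁, s₂]`. Then the
`(≤ n₁ | ≥ n₂)` coexistence is excluded in every canonical thermal state at `(β; t, s, U; n)` for every `(s, U)` of the cell (the
`n₂`-floor is the `U`-chord of the laws; the anchored slack at `β` dominates the one at `β₀`, which is the `U`-chord of the column slacks).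
[cite: Israel1979, Thm. I.2.4] [cite: PoulinHastings2011, eqs. (3)–(8)] [cite: Ruelle1969, §3.3] -/
theorem psT_not_thermal_mix_on_cell_of_columns_hotAnchor (t : ℝ) {s₁ s₂ U₁ U₂ n₁ n₂ a b c₀ c₁ β β₀ βh₁ βh₂ π₁ π₂ : ℝ}
    (hU₁ : 0 ≤ U₁) (h12 : U₁ < U₂) (hn₁ : 0 ≤ n₁) (hn : n₁ < n₂) (hn₂ : n₂ < 2) (ha : 0 ≤ a) (hb : 0 ≤ b)
    (hab : a + b = 1) (hβh₁ : 0 ≤ βh₁) (hβh₂ : 0 ≤ βh₂) (h0₁ : βh₁ ≤ β₀) (h0₂ : βh₂ ≤ β₀) (hβ₀ : β₀ ≤ β)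
    (hβ₀pos : 0 < β₀) {L₁ L₂ F₁ : ℝ → ℝ}
    (hC : ∀ s ∈ Icc s₁ s₂, ∀ U ∈ Icc U₁ U₂, energyDensityTT' t s U (a * n₁ + b * n₂) ≤ c₀ + c₁ * U)
    (hL₁ : ∀ s ∈ Icc s₁ s₂, L₁ s ≤ energyDensityTT' t s U₁ n₂) (hL₂ : ∀ s ∈ Icc s₁ s₂, L₂ s ≤ energyDensityTT' t s U₂ n₂)
    (hF₁ : ∀ s ∈ Icc s₁ s₂, ∀ U ∈ Icc U₁ U₂, F₁ s ≤ energyDensityTT' t s U n₁)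
    (hπ₁ : ∀ s ∈ Icc s₁ s₂, ∀ U ∈ Icc U₁ U₂, pressureTT' βh₁ t s U n₁ ≤ π₁)
    (hπ₂ : ∀ s ∈ Icc s₁ s₂, ∀ U ∈ Icc U₁ U₂, pressureTT' βh₂ t s U n₂ ≤ π₂)
    (hm₁ : ∀ s ∈ Icc s₁ s₂, 0 ≤ a * F₁ s + b * L₁ s - (c₀ + c₁ * U₁))
    (hm₂ : ∀ s ∈ Icc s₁ s₂, 0 ≤ a * F₁ s + b * L₂ s - (c₀ + c₁ * U₂))
    (hg₁ : ∀ s ∈ Icc s₁ s₂,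
      a * π₁ + b * π₂ + βh₁ * (a * F₁ s) + βh₂ * (b * L₁ s) < β₀ * (a * F₁ s + b * L₁ s - (c₀ + c₁ * U₁)))
    (hg₂ : ∀ s ∈ Icc s₁ s₂,
      a * π₁ + b * π₂ + βh₁ * (a * F₁ s) + βh₂ * (b * L₂ s) < β₀ * (a * F₁ s + b * L₂ s - (c₀ + c₁ * U₂)))
    {s : ℝ} (hs : s ∈ Icc s₁ s₂) {U : ℝ} (hU : U ∈ Icc U₁ U₂)
    {ω₁ ω₂ : InfVolFermionState 2} (h₁ : ω₁.IsTranslationInvariant) (h₂ : ω₂.IsTranslationInvariant)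
    (hρ₁ : 0 < ω₁.density) (hρ₁' : ω₁.density ≤ n₁) (hρ₂ : n₂ ≤ ω₂.density) (hρ₂' : ω₂.density < 2)
    {n : ℝ} (hn0 : 0 < n) (hn2 : n < 2) {lam : ℝ} (hl0 : 0 < lam) (hl1 : lam < 1) {Ls : ℕ → ℕ}
    (hLs : Tendsto Ls atTop atTop) :
    ¬ (mix lam hl0.le hl1.le ω₁ ω₂).IsTorusLimitOfMixture (sectorGibbsCount n) (fun L => sectorGibbsWeightTT' β t s U n L)
      (fun L => sectorGibbsVectorTT' t s U n L) Ls := by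
  have hn2' : 0 ≤ n₂ := hn₁.trans hn.le
  have hβ0pos : 0 < β := hβ₀pos.trans_le hβ₀
  refine psT_not_thermal_mix_on_cell_of_fns_hotAnchor t hU₁ hβ0pos hn₁ hn hn₂ ha hb hab hβh₁ hβh₂ (h0₁.trans hβ₀)
    (h0₂.trans hβ₀) (C := fun _ U => c₀ + c₁ * U) (F₁ := fun s _ => F₁ s)
    (F₂ := fun s U => ((U₂ - U) * L₁ s + (U - U₁) * L₂ s) / (U₂ - U₁)) hC hF₁
    (floor_on_cell_of_columnLaws t hn2' hn₂ hU₁ h12 hL₁ hL₂) hπ₁ hπ₂ ?_ hs hU h₁ h₂ hρ₁ hρ₁' hρ₂ hρ₂' hn0 hn2 hl0 hl1 hLs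
  intro s hs U hU
  have hd : (U₂ - U₁) ≠ 0 := (sub_pos.2 h12).ne'
  -- the anchored slack at `β₀` is the `U`-chord of the column slacks
  have e₁ : a * π₁ + b * π₂ <
      β₀ * (a * F₁ s + b * L₁ s - (c₀ + c₁ * U₁)) - (βh₁ * (a * F₁ s) + βh₂ * (b * L₁ s)) := by
    have := hg₁ s hs; linarith
  have e₂ : a * π₁ + b * π₂ <
      β₀ * (a * F₁ s + b * L₂ s - (c₀ + c₁ * U₂)) - (βh₁ * (a * F₁ s) + βh₂ * (b * L₂ s)) := by
    have := hg₂ s hs; linarith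
  have hchord := chord_gt_of_ends_gt h12 hU e₁ e₂
  have hid : β₀ * (a * F₁ s + b * (((U₂ - U) * L₁ s + (U - U₁) * L₂ s) / (U₂ - U₁)) - (c₀ + c₁ * U)) -
        (βh₁ * (a * F₁ s) + βh₂ * (b * (((U₂ - U) * L₁ s + (U - U₁) * L₂ s) / (U₂ - U₁)))) =
      ((U₂ - U) * (β₀ * (a * F₁ s + b * L₁ s - (c₀ + c₁ * U₁)) - (βh₁ * (a * F₁ s) + βh₂ * (b * L₁ s))) +
        (U - U₁) * (β₀ * (a * F₁ s + b * L₂ s - (c₀ + c₁ * U₂)) - (βh₁ * (a * F₁ s) + βh₂ * (b * L₂ s)))) /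
        (U₂ - U₁) := by
    field_simp
    ring
  rw [← hid] at hchord
  -- the `T = 0` margin at `(s, U)` is the chord of the column margins, hence `≥ 0`, so `β·M ≥ β₀·M`
  have hge := chord_ge_of_ends_ge h12 hU (hm₁ s hs) (hm₂ s hs)
  have hidM : a * F₁ s + b * (((U₂ - U) * L₁ s + (U - U₁) * L₂ s) / (U₂ - U₁)) - (c₀ + c₁ * U) =
      ((U₂ - U) * (a * F₁ s + b * L₁ s - (c₀ + c₁ * U₁)) + (U - U₁) * (a * F₁ s + b * L₂ s - (c₀ + c₁ * U₂))) /
        (U₂ - U₁) := by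
    field_simp
    ring
  have hM : 0 ≤ a * F₁ s + b * (((U₂ - U) * L₁ s + (U - U₁) * L₂ s) / (U₂ - U₁)) - (c₀ + c₁ * U) := hidM ▸ hge
  have k := mul_le_mul_of_nonneg_right hβ₀ hM
  show a * π₁ + b * π₂ + βh₁ * (a * F₁ s) + βh₂ * (b * (((U₂ - U) * L₁ s + (U - U₁) * L₂ s) / (U₂ - U₁))) <
    β * (a * F₁ s + b * (((U₂ - U) * L₁ s + (U - U₁) * L₂ s) / (U₂ - U₁)) - (c₀ + c₁ * U))
  linarith

/-- **HOT-ANCHORED THERMAL PS EXCLUSION ABOVE A COLUMN (threshold form).** For `U ∈ [U₂, U₃]` (`U₂ ≥ 0`): a cap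
`e(t, s, U, a n₁ + b n₂) ≤ c₀ + c₁·U` with `c₁ ≥ 0`, ONE column law `L(s) ≤ e(t, s, U₂, n₂)`, a dilute floor `F₁(s)` on the cell,
cell-uniform anchors `π₁, π₂` (`0 ≤ β_{h,i} ≤ β₀ ≤ β`), the FAR-END `T = 0` margin `a F₁(s) + b L(s) − (c₀ + c₁U₃) ≥ 0` and the
anchored inequality at `(β₀, U₃)` for every `s`: the coexistence is excluded on the whole cell at `β`.
[cite: Israel1979, Thm. I.2.4] [cite: Griffiths1966, §II] [cite: PoulinHastings2011, eqs. (3)–(8)] -/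
theorem psT_not_thermal_mix_above_column_hotAnchor (t : ℝ) {s₁ s₂ U₂ U₃ n₁ n₂ a b c₀ c₁ β β₀ βh₁ βh₂ π₁ π₂ : ℝ}
    (hU₂ : 0 ≤ U₂) (hc₁ : 0 ≤ c₁) (hn₁ : 0 ≤ n₁) (hn : n₁ < n₂) (hn₂ : n₂ < 2) (ha : 0 ≤ a) (hb : 0 ≤ b)
    (hab : a + b = 1) (hβh₁ : 0 ≤ βh₁) (hβh₂ : 0 ≤ βh₂) (h0₁ : βh₁ ≤ β₀) (h0₂ : βh₂ ≤ β₀) (hβ₀ : β₀ ≤ β) (hβ₀pos : 0 < β₀)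
    {L F₁ : ℝ → ℝ}
    (hC : ∀ s ∈ Icc s₁ s₂, ∀ U ∈ Icc U₂ U₃, energyDensityTT' t s U (a * n₁ + b * n₂) ≤ c₀ + c₁ * U)
    (hL : ∀ s ∈ Icc s₁ s₂, L s ≤ energyDensityTT' t s U₂ n₂)
    (hF₁ : ∀ s ∈ Icc s₁ s₂, ∀ U ∈ Icc U₂ U₃, F₁ s ≤ energyDensityTT' t s U n₁)
    (hπ₁ : ∀ s ∈ Icc s₁ s₂, ∀ U ∈ Icc U₂ U₃, pressureTT' βh₁ t s U n₁ ≤ π₁)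
    (hπ₂ : ∀ s ∈ Icc s₁ s₂, ∀ U ∈ Icc U₂ U₃, pressureTT' βh₂ t s U n₂ ≤ π₂)
    (hm : ∀ s ∈ Icc s₁ s₂, 0 ≤ a * F₁ s + b * L s - (c₀ + c₁ * U₃))
    (hg : ∀ s ∈ Icc s₁ s₂,
      a * π₁ + b * π₂ + βh₁ * (a * F₁ s) + βh₂ * (b * L s) < β₀ * (a * F₁ s + b * L s - (c₀ + c₁ * U₃)))
    {s : ℝ} (hs : s ∈ Icc s₁ s₂) {U : ℝ} (hU : U ∈ Icc U₂ U₃)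
    {ω₁ ω₂ : InfVolFermionState 2} (h₁ : ω₁.IsTranslationInvariant) (h₂ : ω₂.IsTranslationInvariant)
    (hρ₁ : 0 < ω₁.density) (hρ₁' : ω₁.density ≤ n₁) (hρ₂ : n₂ ≤ ω₂.density) (hρ₂' : ω₂.density < 2)
    {n : ℝ} (hn0 : 0 < n) (hn2 : n < 2) {lam : ℝ} (hl0 : 0 < lam) (hl1 : lam < 1) {Ls : ℕ → ℕ}
    (hLs : Tendsto Ls atTop atTop) :
    ¬ (mix lam hl0.le hl1.le ω₁ ω₂).IsTorusLimitOfMixture (sectorGibbsCount n) (fun L => sectorGibbsWeightTT' β t s U n L)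
      (fun L => sectorGibbsVectorTT' t s U n L) Ls := by
  have hn2' : 0 ≤ n₂ := hn₁.trans hn.le
  refine psT_not_thermal_mix_on_cell_of_fns_hotAnchor t hU₂ (hβ₀pos.trans_le hβ₀) hn₁ hn hn₂ ha hb hab hβh₁ hβh₂
    (h0₁.trans hβ₀) (h0₂.trans hβ₀) (C := fun _ U => c₀ + c₁ * U) (F₁ := fun s _ => F₁ s) (F₂ := fun s _ => L s) hC hF₁
    (fun s hs U hU => floor_above_column_of_law t hn2' hn₂ hU₂ hL s hs U hU.1) hπ₁ hπ₂ ?_ hs hU h₁ h₂ hρ₁ hρ₁' hρ₂ hρ₂'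
    hn0 hn2 hl0 hl1 hLs
  intro s hs U hU
  have k := mul_le_mul_of_nonneg_left hU.2 hc₁
  have hM3 := hm s hs
  have hM : a * F₁ s + b * L s - (c₀ + c₁ * U₃) ≤ a * F₁ s + b * L s - (c₀ + c₁ * U) := by linarith
  have hMU : 0 ≤ a * F₁ s + b * L s - (c₀ + c₁ * U) := hM3.trans hM
  have k1 := mul_le_mul_of_nonneg_left hM hβ₀pos.le
  have k2 := mul_le_mul_of_nonneg_right hβ₀ hMU
  have hg' := hg s hs
  show a * π₁ + b * π₂ + βh₁ * (a * F₁ s) + βh₂ * (b * L s) < β * (a * F₁ s + b * L s - (c₀ + c₁ * U))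
  linarith


/-! ## §5 `t′`-CHORD ANCHORS and `s`-DEPENDENT anchored ceilings (g24 append)

Two pressure anchors at the SAME `β_h` and density, `p(β_h; t, s_a, U_a; n) ≤ V_a` and `p(β_h; t, s_b, U_b; n) ≤ V_b` (`s_a < s_b`), cap the
pressure on `[s_a, s_b] × U ≥ max(U_a, U_b)` by the `t′`-CHORD `((s_b − s)V_a + (s − s_a)V_b)/(s_b − s_a)` (two-point Jensen in `t′`,
antitonicity in `U`) — an anchored ceiling AFFINE in `s`. The column × threshold forms below take the `n₂`-anchor as a FUNCTION `Q₂(s)`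
(affine ⇒ the anchored inequality is still checked at the two `s`-ends of each column). Use: corner anchors at `t′ ∈ {−5/16, −3/16}` chorded
with the cuprate-point anchor at `t′ = −1/4` (equal `β_h`) on the La-214 cell. -/

/-- **`t′`-CHORD OF TWO ANCHORS** (generic; `β ≥ 0`, `0 ≤ n < 2`, `s_a < s_b`, `U_a, U_b ≥ 0`): anchors `p(β; t, s_a, U_a; n) ≤ V_a` and
`p(β; t, s_b, U_b; n) ≤ V_b` give `p(β; t, s, U; n) ≤ ((s_b − s)·V_a + (s − s_a)·V_b)/(s_b − s_a)` for every `s ∈ [s₁, s₂] ⊆ [s_a, s_b]` and every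
`U ∈ [U₁, U₂]` with `U₁ ≥ U_a`, `U₁ ≥ U_b` (convexity in `t′` at fixed `U`, then antitonicity in `U` at each end).
[cite: Israel1979, Thm. I.3.4] [cite: Griffiths1966, §II] -/
theorem pressureTT'_le_schord_of_anchors {β : ℝ} (hβ : 0 ≤ β) (t : ℝ) {n : ℝ} (hn0 : 0 ≤ n) (hn2 : n < 2)
    {sa sb Ua Ub Va Vb : ℝ} (hUa : 0 ≤ Ua) (hUb : 0 ≤ Ub) (hab : sa < sb)
    (hA : pressureTT' β t sa Ua n ≤ Va) (hB : pressureTT' β t sb Ub n ≤ Vb)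
    {s₁ s₂ U₁ U₂ : ℝ} (hs₁ : sa ≤ s₁) (hs₂ : s₂ ≤ sb) (hU₁a : Ua ≤ U₁) (hU₁b : Ub ≤ U₁) :
    ∀ s ∈ Icc s₁ s₂, ∀ U ∈ Icc U₁ U₂, pressureTT' β t s U n ≤ ((sb - s) * Va + (s - sa) * Vb) / (sb - sa) := by
  intro s hs U hU
  have hd : 0 < sb - sa := sub_pos.2 hab
  have hsa : sa ≤ s := hs₁.trans hs.1
  have hsb : s ≤ sb := hs.2.trans hs₂
  have hU0 : 0 ≤ U := hUa.trans (hU₁a.trans hU.1)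
  have hl : 0 ≤ (sb - s) / (sb - sa) := div_nonneg (sub_nonneg.2 hsb) hd.le
  have hm : 0 ≤ (s - sa) / (sb - sa) := div_nonneg (sub_nonneg.2 hsa) hd.le
  have hlm : (sb - s) / (sb - sa) + (s - sa) / (sb - sa) = 1 := by
    field_simp; ring
  have hss : (sb - s) / (sb - sa) * sa + (s - sa) / (sb - sa) * sb = s := by
    field_simp; ring
  have hJ := pressureTT'_le_convexComb_tPrime hn0 hn2 hβ t hU0 hl hm hlm hss
  have ha' : pressureTT' β t sa U n ≤ Va := (pressureTT'_anti_U hn0 hn2 hβ t sa hUa (hU₁a.trans hU.1)).trans hA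
  have hb' : pressureTT' β t sb U n ≤ Vb := (pressureTT'_anti_U hn0 hn2 hβ t sb hUb (hU₁b.trans hU.1)).trans hB
  have k1 := mul_le_mul_of_nonneg_left ha' hl
  have k2 := mul_le_mul_of_nonneg_left hb' hm
  have hid : (sb - s) / (sb - sa) * Va + (s - sa) / (sb - sa) * Vb = ((sb - s) * Va + (s - sa) * Vb) / (sb - sa) := by
    field_simp
  linarith [hJ, k1, k2, hid.symm.le, hid.le]

/-- **HOT-ANCHORED THERMAL PS EXCLUSION ON A CELL from bound functions, `s`/`U`-DEPENDENT ANCHORS.** As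
`psT_not_thermal_mix_on_cell_of_fns_hotAnchor`, but the pressure ceilings at the outer densities are FUNCTIONS `P₁(s, U)`, `P₂(s, U)` on the cell
(e.g. `t′`-chords of anchors), and the anchored inequality is required pointwise with them. [cite: Israel1979, Thm. I.2.4] [cite: PoulinHastings2011, eqs. (3)–(8)] -/
theorem psT_not_thermal_mix_on_cell_of_fns_hotAnchorFn (t : ℝ) {s₁ s₂ U₁ U₂ n₁ n₂ a b β βh₁ βh₂ : ℝ} (hU₁ : 0 ≤ U₁)
    (hβ : 0 < β) (hn₁ : 0 ≤ n₁) (hn : n₁ < n₂) (hn₂ : n₂ < 2) (ha : 0 ≤ a) (hb : 0 ≤ b) (hab : a + b = 1)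
    (hβh₁ : 0 ≤ βh₁) (hβh₂ : 0 ≤ βh₂) (hle₁ : βh₁ ≤ β) (hle₂ : βh₂ ≤ β) {C F₁ F₂ P₁ P₂ : ℝ → ℝ → ℝ}
    (hC : ∀ s ∈ Icc s₁ s₂, ∀ U ∈ Icc U₁ U₂, energyDensityTT' t s U (a * n₁ + b * n₂) ≤ C s U)
    (hF₁ : ∀ s ∈ Icc s₁ s₂, ∀ U ∈ Icc U₁ U₂, F₁ s U ≤ energyDensityTT' t s U n₁)
    (hF₂ : ∀ s ∈ Icc s₁ s₂, ∀ U ∈ Icc U₁ U₂, F₂ s U ≤ energyDensityTT' t s U n₂)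
    (hπ₁ : ∀ s ∈ Icc s₁ s₂, ∀ U ∈ Icc U₁ U₂, pressureTT' βh₁ t s U n₁ ≤ P₁ s U)
    (hπ₂ : ∀ s ∈ Icc s₁ s₂, ∀ U ∈ Icc U₁ U₂, pressureTT' βh₂ t s U n₂ ≤ P₂ s U)
    (hpos : ∀ s ∈ Icc s₁ s₂, ∀ U ∈ Icc U₁ U₂,
      a * P₁ s U + b * P₂ s U + βh₁ * (a * F₁ s U) + βh₂ * (b * F₂ s U) < β * (a * F₁ s U + b * F₂ s U - C s U))
    {s : ℝ} (hs : s ∈ Icc s₁ s₂) {U : ℝ} (hU : U ∈ Icc U₁ U₂)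
    {ω₁ ω₂ : InfVolFermionState 2} (h₁ : ω₁.IsTranslationInvariant) (h₂ : ω₂.IsTranslationInvariant)
    (hρ₁ : 0 < ω₁.density) (hρ₁' : ω₁.density ≤ n₁) (hρ₂ : n₂ ≤ ω₂.density) (hρ₂' : ω₂.density < 2)
    {n : ℝ} (hn0 : 0 < n) (hn2 : n < 2) {lam : ℝ} (hl0 : 0 < lam) (hl1 : lam < 1) {Ls : ℕ → ℕ}
    (hLs : Tendsto Ls atTop atTop) :
    ¬ (mix lam hl0.le hl1.le ω₁ ω₂).IsTorusLimitOfMixture (sectorGibbsCount n) (fun L => sectorGibbsWeightTT' β t s U n L)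
      (fun L => sectorGibbsVectorTT' t s U n L) Ls :=
  not_isTorusLimitOfMixture_mix_of_hotAnchors_of_le t s (hU₁.trans hU.1) hβ h₁ h₂ hρ₁ hρ₂' hn₁ hn₂ hρ₁' hn hρ₂ ha hb hab
    (hC s hs U hU) (hF₁ s hs U hU) (hF₂ s hs U hU) hβh₁ hβh₂ hle₁ hle₂ (hπ₁ s hs U hU) (hπ₂ s hs U hU) (hpos s hs U hU)
    hn0 hn2 hl0 hl1 hLs

/-- **COLUMN × THRESHOLD FORM WITH AN `s`-DEPENDENT `n₂`-ANCHOR `Q₂(s)`** (e.g. a `t′`-chord of two equal-`β_h` anchors): as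
`psT_not_thermal_mix_on_cell_of_columns_hotAnchor` with `b·π₂` replaced by `b·Q₂(s)` in the anchored inequality on both columns (for `Q₂`
affine in `s` it is checked at the two `s`-ends). [cite: Israel1979, Thm. I.2.4] [cite: PoulinHastings2011, eqs. (3)–(8)] [cite: Ruelle1969, §3.3] -/
theorem psT_not_thermal_mix_on_cell_of_columns_hotAnchorS (t : ℝ) {s₁ s₂ U₁ U₂ n₁ n₂ a b c₀ c₁ β β₀ βh₁ βh₂ π₁ : ℝ}
    (hU₁ : 0 ≤ U₁) (h12 : U₁ < U₂) (hn₁ : 0 ≤ n₁) (hn : n₁ < n₂) (hn₂ : n₂ < 2) (ha : 0 ≤ a) (hb : 0 ≤ b)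
    (hab : a + b = 1) (hβh₁ : 0 ≤ βh₁) (hβh₂ : 0 ≤ βh₂) (h0₁ : βh₁ ≤ β₀) (h0₂ : βh₂ ≤ β₀) (hβ₀ : β₀ ≤ β)
    (hβ₀pos : 0 < β₀) {L₁ L₂ F₁ Q₂ : ℝ → ℝ}
    (hC : ∀ s ∈ Icc s₁ s₂, ∀ U ∈ Icc U₁ U₂, energyDensityTT' t s U (a * n₁ + b * n₂) ≤ c₀ + c₁ * U)
    (hL₁ : ∀ s ∈ Icc s₁ s₂, L₁ s ≤ energyDensityTT' t s U₁ n₂) (hL₂ : ∀ s ∈ Icc s₁ s₂, L₂ s ≤ energyDensityTT' t s U₂ n₂)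
    (hF₁ : ∀ s ∈ Icc s₁ s₂, ∀ U ∈ Icc U₁ U₂, F₁ s ≤ energyDensityTT' t s U n₁)
    (hπ₁ : ∀ s ∈ Icc s₁ s₂, ∀ U ∈ Icc U₁ U₂, pressureTT' βh₁ t s U n₁ ≤ π₁)
    (hπ₂ : ∀ s ∈ Icc s₁ s₂, ∀ U ∈ Icc U₁ U₂, pressureTT' βh₂ t s U n₂ ≤ Q₂ s)
    (hm₁ : ∀ s ∈ Icc s₁ s₂, 0 ≤ a * F₁ s + b * L₁ s - (c₀ + c₁ * U₁))
    (hm₂ : ∀ s ∈ Icc s₁ s₂, 0 ≤ a * F₁ s + b * L₂ s - (c₀ + c₁ * U₂))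
    (hg₁ : ∀ s ∈ Icc s₁ s₂,
      a * π₁ + b * Q₂ s + βh₁ * (a * F₁ s) + βh₂ * (b * L₁ s) < β₀ * (a * F₁ s + b * L₁ s - (c₀ + c₁ * U₁)))
    (hg₂ : ∀ s ∈ Icc s₁ s₂,
      a * π₁ + b * Q₂ s + βh₁ * (a * F₁ s) + βh₂ * (b * L₂ s) < β₀ * (a * F₁ s + b * L₂ s - (c₀ + c₁ * U₂)))
    {s : ℝ} (hs : s ∈ Icc s₁ s₂) {U : ℝ} (hU : U ∈ Icc U₁ U₂)
    {ω₁ ω₂ : InfVolFermionState 2} (h₁ : ω₁.IsTranslationInvariant) (h₂ : ω₂.IsTranslationInvariant)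
    (hρ₁ : 0 < ω₁.density) (hρ₁' : ω₁.density ≤ n₁) (hρ₂ : n₂ ≤ ω₂.density) (hρ₂' : ω₂.density < 2)
    {n : ℝ} (hn0 : 0 < n) (hn2 : n < 2) {lam : ℝ} (hl0 : 0 < lam) (hl1 : lam < 1) {Ls : ℕ → ℕ}
    (hLs : Tendsto Ls atTop atTop) :
    ¬ (mix lam hl0.le hl1.le ω₁ ω₂).IsTorusLimitOfMixture (sectorGibbsCount n) (fun L => sectorGibbsWeightTT' β t s U n L)
      (fun L => sectorGibbsVectorTT' t s U n L) Ls := by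
  have hn2' : 0 ≤ n₂ := hn₁.trans hn.le
  have hβ0pos : 0 < β := hβ₀pos.trans_le hβ₀
  refine psT_not_thermal_mix_on_cell_of_fns_hotAnchorFn t hU₁ hβ0pos hn₁ hn hn₂ ha hb hab hβh₁ hβh₂ (h0₁.trans hβ₀)
    (h0₂.trans hβ₀) (C := fun _ U => c₀ + c₁ * U) (F₁ := fun s _ => F₁ s)
    (F₂ := fun s U => ((U₂ - U) * L₁ s + (U - U₁) * L₂ s) / (U₂ - U₁)) (P₁ := fun _ _ => π₁) (P₂ := fun s _ => Q₂ s) hC hF₁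
    (floor_on_cell_of_columnLaws t hn2' hn₂ hU₁ h12 hL₁ hL₂) hπ₁ hπ₂ ?_ hs hU h₁ h₂ hρ₁ hρ₁' hρ₂ hρ₂' hn0 hn2 hl0 hl1 hLs
  intro s hs U hU
  have hd : (U₂ - U₁) ≠ 0 := (sub_pos.2 h12).ne'
  have e₁ : a * π₁ + b * Q₂ s <
      β₀ * (a * F₁ s + b * L₁ s - (c₀ + c₁ * U₁)) - (βh₁ * (a * F₁ s) + βh₂ * (b * L₁ s)) := by
    have := hg₁ s hs; linarith
  have e₂ : a * π₁ + b * Q₂ s <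
      β₀ * (a * F₁ s + b * L₂ s - (c₀ + c₁ * U₂)) - (βh₁ * (a * F₁ s) + βh₂ * (b * L₂ s)) := by
    have := hg₂ s hs; linarith
  have hchord := chord_gt_of_ends_gt h12 hU e₁ e₂
  have hid : β₀ * (a * F₁ s + b * (((U₂ - U) * L₁ s + (U - U₁) * L₂ s) / (U₂ - U₁)) - (c₀ + c₁ * U)) -
        (βh₁ * (a * F₁ s) + βh₂ * (b * (((U₂ - U) * L₁ s + (U - U₁) * L₂ s) / (U₂ - U₁)))) =
      ((U₂ - U) * (β₀ * (a * F₁ s + b * L₁ s - (c₀ + c₁ * U₁)) - (βh₁ * (a * F₁ s) + βh₂ * (b * L₁ s))) +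
        (U - U₁) * (β₀ * (a * F₁ s + b * L₂ s - (c₀ + c₁ * U₂)) - (βh₁ * (a * F₁ s) + βh₂ * (b * L₂ s)))) /
        (U₂ - U₁) := by
    field_simp
    ring
  rw [← hid] at hchord
  have hge := chord_ge_of_ends_ge h12 hU (hm₁ s hs) (hm₂ s hs)
  have hidM : a * F₁ s + b * (((U₂ - U) * L₁ s + (U - U₁) * L₂ s) / (U₂ - U₁)) - (c₀ + c₁ * U) =
      ((U₂ - U) * (a * F₁ s + b * L₁ s - (c₀ + c₁ * U₁)) + (U - U₁) * (a * F₁ s + b * L₂ s - (c₀ + c₁ * U₂))) /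
        (U₂ - U₁) := by
    field_simp
    ring
  have hM : 0 ≤ a * F₁ s + b * (((U₂ - U) * L₁ s + (U - U₁) * L₂ s) / (U₂ - U₁)) - (c₀ + c₁ * U) := hidM ▸ hge
  have k := mul_le_mul_of_nonneg_right hβ₀ hM
  show a * π₁ + b * Q₂ s + βh₁ * (a * F₁ s) + βh₂ * (b * (((U₂ - U) * L₁ s + (U - U₁) * L₂ s) / (U₂ - U₁))) <
    β * (a * F₁ s + b * (((U₂ - U) * L₁ s + (U - U₁) * L₂ s) / (U₂ - U₁)) - (c₀ + c₁ * U))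
  linarith

/-- **ABOVE A COLUMN WITH AN `s`-DEPENDENT `n₂`-ANCHOR `Q₂(s)`**: as `psT_not_thermal_mix_above_column_hotAnchor` (cap non-decreasing in
`U`, one column law, far-end check) with `b·π₂` replaced by `b·Q₂(s)`. [cite: Israel1979, Thm. I.2.4] [cite: Griffiths1966, §II] [cite: PoulinHastings2011, eqs. (3)–(8)] -/
theorem psT_not_thermal_mix_above_column_hotAnchorS (t : ℝ) {s₁ s₂ U₂ U₃ n₁ n₂ a b c₀ c₁ β β₀ βh₁ βh₂ π₁ : ℝ}
    (hU₂ : 0 ≤ U₂) (hc₁ : 0 ≤ c₁) (hn₁ : 0 ≤ n₁) (hn : n₁ < n₂) (hn₂ : n₂ < 2) (ha : 0 ≤ a) (hb : 0 ≤ b)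
    (hab : a + b = 1) (hβh₁ : 0 ≤ βh₁) (hβh₂ : 0 ≤ βh₂) (h0₁ : βh₁ ≤ β₀) (h0₂ : βh₂ ≤ β₀) (hβ₀ : β₀ ≤ β) (hβ₀pos : 0 < β₀)
    {L F₁ Q₂ : ℝ → ℝ}
    (hC : ∀ s ∈ Icc s₁ s₂, ∀ U ∈ Icc U₂ U₃, energyDensityTT' t s U (a * n₁ + b * n₂) ≤ c₀ + c₁ * U)
    (hL : ∀ s ∈ Icc s₁ s₂, L s ≤ energyDensityTT' t s U₂ n₂)
    (hF₁ : ∀ s ∈ Icc s₁ s₂, ∀ U ∈ Icc U₂ U₃, F₁ s ≤ energyDensityTT' t s U n₁)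
    (hπ₁ : ∀ s ∈ Icc s₁ s₂, ∀ U ∈ Icc U₂ U₃, pressureTT' βh₁ t s U n₁ ≤ π₁)
    (hπ₂ : ∀ s ∈ Icc s₁ s₂, ∀ U ∈ Icc U₂ U₃, pressureTT' βh₂ t s U n₂ ≤ Q₂ s)
    (hm : ∀ s ∈ Icc s₁ s₂, 0 ≤ a * F₁ s + b * L s - (c₀ + c₁ * U₃))
    (hg : ∀ s ∈ Icc s₁ s₂,
      a * π₁ + b * Q₂ s + βh₁ * (a * F₁ s) + βh₂ * (b * L s) < β₀ * (a * F₁ s + b * L s - (c₀ + c₁ * U₃)))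
    {s : ℝ} (hs : s ∈ Icc s₁ s₂) {U : ℝ} (hU : U ∈ Icc U₂ U₃)
    {ω₁ ω₂ : InfVolFermionState 2} (h₁ : ω₁.IsTranslationInvariant) (h₂ : ω₂.IsTranslationInvariant)
    (hρ₁ : 0 < ω₁.density) (hρ₁' : ω₁.density ≤ n₁) (hρ₂ : n₂ ≤ ω₂.density) (hρ₂' : ω₂.density < 2)
    {n : ℝ} (hn0 : 0 < n) (hn2 : n < 2) {lam : ℝ} (hl0 : 0 < lam) (hl1 : lam < 1) {Ls : ℕ → ℕ}
    (hLs : Tendsto Ls atTop atTop) :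
    ¬ (mix lam hl0.le hl1.le ω₁ ω₂).IsTorusLimitOfMixture (sectorGibbsCount n) (fun L => sectorGibbsWeightTT' β t s U n L)
      (fun L => sectorGibbsVectorTT' t s U n L) Ls := by
  have hn2' : 0 ≤ n₂ := hn₁.trans hn.le
  refine psT_not_thermal_mix_on_cell_of_fns_hotAnchorFn t hU₂ (hβ₀pos.trans_le hβ₀) hn₁ hn hn₂ ha hb hab hβh₁ hβh₂
    (h0₁.trans hβ₀) (h0₂.trans hβ₀) (C := fun _ U => c₀ + c₁ * U) (F₁ := fun s _ => F₁ s) (F₂ := fun s _ => L s)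
    (P₁ := fun _ _ => π₁) (P₂ := fun s _ => Q₂ s) hC hF₁
    (fun s hs U hU => floor_above_column_of_law t hn2' hn₂ hU₂ hL s hs U hU.1) hπ₁ hπ₂ ?_ hs hU h₁ h₂ hρ₁ hρ₁' hρ₂ hρ₂'
    hn0 hn2 hl0 hl1 hLs
  intro s hs U hU
  have k := mul_le_mul_of_nonneg_left hU.2 hc₁
  have hM3 := hm s hs
  have hM : a * F₁ s + b * L s - (c₀ + c₁ * U₃) ≤ a * F₁ s + b * L s - (c₀ + c₁ * U) := by linarith
  have hMU : 0 ≤ a * F₁ s + b * L s - (c₀ + c₁ * U) := hM3.trans hM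
  have k1 := mul_le_mul_of_nonneg_left hM hβ₀pos.le
  have k2 := mul_le_mul_of_nonneg_right hβ₀ hMU
  have hg' := hg s hs
  show a * π₁ + b * Q₂ s + βh₁ * (a * F₁ s) + βh₂ * (b * L s) < β * (a * F₁ s + b * L s - (c₀ + c₁ * U))
  linarith

end Summit.Ventures.CertifiedManyBodySolver.Observables
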